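import Literature.MathematicalPhysics.QuantumFieldTheory.Balaban1983to89.B9Eq326LocalPartDivergenceBlockLetter
import Literature.MathematicalPhysics.QuantumFieldTheory.Balaban1983to89.B9Eq342GradientRowSmallGaugeLetters

/-!
# `Balaban1983to89.B9Eq326LocalPartDivergenceBlockLetterSmallGauge` — T. Bałaban, *Propagators for lattice gauge theories in a background field*, Commun.
# Math. Phys. **99** (1985) 389–434 [Balaban1985BackgroundPropagators] Thm 3.1 (3.42) p. 397 (second entry, the covariant-gradient row, «for x ∈ Δ(y),
# supp λ ⊂ Δ(y′)»), (3.26) p. 395 (the local part `A₀`), (3.35) p. 396, (3.8) p. 392, (3.49) p. 399: **THE BLOCK LETTER (L) OF `D*_U A₀⁻¹` IN THE CELL's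
# MODEL (a background small on every bond) — this lineage's (K53) `B9Eq326LocalPartDivergenceBlockLetter.norm_covDivL2K_le_blockLetter` with EVERY
# centre-independent letter of storey J DISCHARGED by (K54) `B9Eq342GradientRowSmallGaugeLetters`: trivial comparison gauge `g_{b₀} ≡ 1`, trivial localising
# family `χ_{b₀} ≡ 1` (`c∕r = c∕r² = 0`, `Ω_{b₀} = Set.univ`), transporters `R = Ad U`, `S = Ad U⁻¹` (`SR = 1`), fibre letters `δ = b = 2M_φM_φ′ε_U`,
# `b′ = 2M_φM_φ′a_U`.  What stays displayed: the bond equation `L_K u + P u = f` (the OWNER's `A₀ = L_K + P`, `B9Eq326LocalPartKatoForm.localPart_eq_kato_add`),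
# the data over one block (`sup ≤ F` on `B(v)`), the value field's block decay `C_u` (the OWNER t4-ne9-p1 g94's INTENT-3 `B9Eq326LocalPartPointRow`), the
# order-zero implication `c_P` ((K47) §4 ∘ (K51)), the transporter contractions `hR`∕`hS`, the smallness data `ε_U`, `a_U`, and the currency windows
# (`β ≤ B_ν`, `a ≤ κ′`, `|t|B_ν ≤ C ≤ K∕√m`, `2·|t|b·(e^{κ′}+1)·d·K ≤ √m`).  OUTPUT at every site `y`:
# `‖(D*_U u)(y)‖ ≤ 2e^{a(L−1)}·(A + B·C_u)·F·e^{−κ·d_m(πy, v)}`, `A = 2|t|ΣB_ν`, `B = (2(|t|(c_P + |m|) + d·t²(b′ + b²)) + |t|b∕β)·ΣB_ν`** (the OWNER's plan v11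
# §2 (ii): the letter of `D*_UA₀⁻¹`, bonds → sites, in ne9-leaf-03's (L) currency; successor memo `t4/b2b-balaban-t4-ne9-formalise-leaf-05/g85/STOREY-J-A0-MAP-g85.md`
# §3 (c)–(e) CLOSED in the model: no cube, no margin, no cutoff)

statement-level skeleton of published theorems with citation tags; proofs where landed; nothing here is a claim about the Yang–Mills mass gap

CITATION HEADER (lean-in-tree rule).  Audit cell `pub-balaban`, sub-cell `t4`, BINDER row NE9; filed by NE9 crux-team LEAF PROVER 05
(`b2b-balaban-t4-ne9-formalise-leaf-05`, gen 86).  Imports this lineage's (K53) `B9Eq326LocalPartDivergenceBlockLetter` and (K54)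
`B9Eq342GradientRowSmallGaugeLetters` (through them (K48), (K52), (K50), (K30) `B9Eq331PureGaugeResolventConjugation.adTransportW_inv_adTransportW`).  SOURCE READ
first-hand in the held text layer [Balaban1985BackgroundPropagators] (`paper:balaban1985-cmp99-background-propagators`): p. 397 Thm 3.1 (3.42); p. 395 (3.26);
p. 396 (3.35); p. 392 (3.8); p. 399 (3.49).  Print proves the gradient row by the random walk of Sect. 3 over the cubes of the class (3.35); the cell's storey J is
a weighted sup-norm contraction and its model background is small on every bond, where print's localisation is the identity — [folklore] composition BY NAME;
nothing printed is a hypothesis; the `[cite: …]` tags are TEXT LOCATIONS.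

WHAT IS PROVED (sorry-free; 0 `def`; [folklore]).  **`norm_covDivL2K_le_blockLetter_smallGauge`** — on the lattice `TSite d (fineP L m)` (`2 ≤ L·m_ν`, `1 ≤ m_i`;
`t > 0`, `m > 0`, rate `0 ≤ a` with `2dt²(cosh a − 1) < m`), fibre `V` read in `𝔸` along `φ` (`‖φw‖ ≤ M_φ‖w‖`, `‖φ⁻¹X‖ ≤ M_φ′‖X‖`), a background `U` with
`U(b) ∈ U1`, `‖U(b) − 1‖ ≤ ε_U`, `‖U(x,μ) − U(x−e_μ,μ)‖ ≤ a_U`, contracting transporters; a solution of `L_K u + P u = f` (`L_K = bondLapK t (Ad U) (Ad U⁻¹)`,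
`P` any linear map) with data supported over `B(v)`, `sup ≤ F`, value block decay `‖u(b)‖ ≤ C_u·F·e^{−κ·d_m(πb₋, v)}` (`κ ≤ aL`) and the order-zero implication
`c_P` at every centre; the currency windows: the displayed (L) letter above at every site `y`.
HONEST SCOPE.  Composition only; the three rows' suppliers (the OWNER's INTENT-3 for `C_u`, (K47) §4 ∘ (K51) for `c_P`), the Kato-form identification of
`A₀`, `ε_U`∕`a_U` (the (3.35)-type model letters; t-free exactly when `L·ε_U`, `L²·a_U` are `O(1)` at `t = L`) and the currency windows stay DISPLAYED; the
transposed row `A₀⁻¹D_U` is NOT here; nothing of [B9] Thm 3.1∕3.3∕3.11 is asserted, valued or discharged.  NOT NE9 (cell pub-balaban: NE9 NOT PRINTED ∕ NOT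
PROVED; «NE9 ⇐ the named binders»; row WALLED ON A MODEL (O-NE9-1; #5 UNRULED); spine PROVED 0∕9; rung (B)+1 on a finite T⁴ — NOT infinite volume, NOT mass
gap, NOT Clay; HONEST DEPENDENCY: continuum YM on T⁴ ⇐ BetaPertH ∧ nine spine estimates (0/9 proved); BetaPertH ⇐ (D1) ∧ (D4) ∧ CAP+tail; G-an2-4 gates
asym, D1 and NE2/3/4).  NEW file; nothing modified.  Net new unproved facts: 0.
-/

noncomputable section

set_option autoImplicit false

namespace Literature.MathematicalPhysics.QuantumFieldTheory.Balaban1983to89.B9Eq326LocalPartDivergenceBlockLetterSmallGauge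

open scoped BigOperators InnerProductSpace

open B4Sect5Torus (TSite tdist)
open B9SectCLatticeCarrier (Bond bpos btgt shift unshift)
open B4TorusKernel.MultiPeriod (circAbs)
open B9Eq311L2Pairing (WL2)
open B9Eq310HessianOperator (adTransportW)
open B11Eq103H1Complex (BondL2K covDivL2K)
open B7Prop1Explicit (U1)
open B9Eq319QprimeTorus (fineP blockCoord)
open B9Eq326LocalPartKatoForm (bondLapK)
open B9Eq331PureGaugeResolventConjugation (adTransportW_inv_adTransportW)
open B9Eq326LocalPartDivergenceBlockLetter (norm_covDivL2K_le_blockLetter)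
open B9Eq342GradientRowSmallGaugeLetters (inner_AdW_one norm_sub_pureGauge_le norm_rel_sub_le norm_inv_sub_le norm_covDiff_le)

variable {d : ℕ} (L : ℕ) [NeZero L] (m : Fin d → ℕ) [∀ i, NeZero (fineP L m i)] (hm : ∀ i, 1 ≤ m i)
  {𝔸 : Type*} [NormedRing 𝔸] [NormedAlgebra ℂ 𝔸] [NormOneClass 𝔸]
  {V : Type*} [NormedAddCommGroup V] [InnerProductSpace ℂ V] [FiniteDimensional ℂ V] (φ : V ≃ₗ[ℂ] 𝔸) {Mφ Mφ' : ℝ}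
  (hφ : ∀ w, ‖φ w‖ ≤ Mφ * ‖w‖) (hφ' : ∀ X, ‖φ.symm X‖ ≤ Mφ' * ‖X‖) (hMφ : 0 ≤ Mφ) (hMφ' : 0 ≤ Mφ')
  {c₁ : ℝ} [Fact (0 < c₁)] (t mm a : ℝ) (hmm : 0 < mm)
  (U : Bond d (fineP L m) → 𝔸ˣ) (hU1 : ∀ b, U b ∈ U1 𝔸) {εU aU : ℝ} (hεU : 0 ≤ εU) (haU : 0 ≤ aU)
  (hUε : ∀ b, ‖(U b : 𝔸) - 1‖ ≤ εU) (hUa : ∀ (x : TSite d (fineP L m)) (μ : Fin d), ‖(U (x, μ) : 𝔸) - (U (unshift μ x, μ) : 𝔸)‖ ≤ aU)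

include hm hφ hφ' hMφ hMφ' hmm hU1 hεU haU hUε hUa in
/-- **THE BLOCK LETTER (L) OF THE DIVERGENCE OF THE LOCAL PART's SOLUTION, SMALL-GAUGE MODEL** — see the module header: (K53) with the comparison gauges,
the localising family and the fibre letters discharged by (K54); block-supported data, block-decaying value field and the order-zero implication give
`‖(D*_U u)(y)‖ ≤ 2e^{a(L−1)}·(A + B·C_u)·F·e^{−κ·d_m(πy, v)}` with `b = 2M_φM_φ′ε_U`, `b′ = 2M_φM_φ′a_U` inside `B`. [folklore]
[cite: Balaban1985BackgroundPropagators, Thm 3.1 (3.42) p.397, (3.26) p.395, (3.35) p.396, (3.8) p.392, (3.49) p.399] -/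
theorem norm_covDivL2K_le_blockLetter_smallGauge (ht : 0 < t) (ha : 0 ≤ a) (hlam : 2 * (d : ℝ) * t ^ 2 * (Real.cosh a - 1) < mm)
    (hn : ∀ ν, 2 ≤ fineP L m ν)
    (hR : ∀ (b : Bond d (fineP L m)) (w : V), ‖adTransportW φ U b w‖ ≤ ‖w‖)
    (hS : ∀ (b : Bond d (fineP L m)) (w : V), ‖adTransportW φ (fun bb => (U bb)⁻¹) b w‖ ≤ ‖w‖)
    (P : BondL2K ℂ d (fineP L m) c₁ V →ₗ[ℂ] BondL2K ℂ d (fineP L m) c₁ V) (u f : BondL2K ℂ d (fineP L m) c₁ V)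
    (hu : bondLapK ℂ c₁ (t : ℂ) (adTransportW φ U) (adTransportW φ fun bb => (U bb)⁻¹) u + P u = f)
    -- the data over one block, the value field with block decay, the order-zero part's row from the value row (centre-uniform)
    (v : TSite d m) {F Cu κ cP : ℝ} (hF : 0 ≤ F) (hCu : 0 ≤ Cu) (hκ : 0 ≤ κ) (hκa : κ ≤ a * (L : ℝ)) (hcP : 0 ≤ cP)
    (hfv : ∀ b : Bond d (fineP L m), blockCoord L m b.1 ≠ v → WL2.equiv ℂ (fun _ : Bond d (fineP L m) => c₁) V f b = 0)
    (hfF : ∀ b : Bond d (fineP L m), ‖WL2.equiv ℂ (fun _ : Bond d (fineP L m) => c₁) V f b‖ ≤ F)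
    (hudec : ∀ b : Bond d (fineP L m), ‖WL2.equiv ℂ (fun _ : Bond d (fineP L m) => c₁) V u b‖ ≤
      Cu * F * Real.exp (-(κ * tdist m (blockCoord L m b.1) v)))
    (hPuv : ∀ (y : TSite d (fineP L m)) (Nu : ℝ), 0 ≤ Nu →
      (∀ b : Bond d (fineP L m), ‖WL2.equiv ℂ (fun _ : Bond d (fineP L m) => c₁) V u b‖ ≤ Nu *
        (fun x : TSite d (fineP L m) =>
          ∏ μ, Real.cosh (a * (circAbs (fineP L m μ) (ZMod.val (((y μ : ℕ) : ZMod (fineP L m μ)) - ((x μ : ℕ) : ZMod (fineP L m μ)))) : ℝ))) b.1) →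
      ∀ b : Bond d (fineP L m), ‖WL2.equiv ℂ (fun _ : Bond d (fineP L m) => c₁) V (P u) b‖ ≤ (cP * Nu) *
        (fun x : TSite d (fineP L m) =>
          ∏ μ, Real.cosh (a * (circAbs (fineP L m μ) (ZMod.val (((y μ : ℕ) : ZMod (fineP L m μ)) - ((x μ : ℕ) : ZMod (fineP L m μ)))) : ℝ))) b.1)
    -- the currency windows
    {β : ℝ} (hβ : 0 < β)
    (hβB : ∀ ν, β ≤ (fun ν : Fin d => (1 + Real.exp (-a)) *
        ((1 + 2 * t / (fineP L m ν * Real.sqrt (mm - 2 * ((d : ℝ) - 1) * t ^ 2 * (Real.cosh a - 1)))) /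
          Real.sqrt ((mm - 2 * ((d : ℝ) - 1) * t ^ 2 * (Real.cosh a - 1)) ^ 2 + 4 * (mm - 2 * ((d : ℝ) - 1) * t ^ 2 * (Real.cosh a - 1)) * t ^ 2)) +
        2 * Real.sinh a / (mm - 2 * (d : ℝ) * t ^ 2 * (Real.cosh a - 1))) ν)
    {κ' C K : ℝ} (haκ : a ≤ κ') (hC : 0 ≤ C)
    (htB : ∀ ν, ‖(t : ℂ)‖ * (fun ν : Fin d => (1 + Real.exp (-a)) *
        ((1 + 2 * t / (fineP L m ν * Real.sqrt (mm - 2 * ((d : ℝ) - 1) * t ^ 2 * (Real.cosh a - 1)))) /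
          Real.sqrt ((mm - 2 * ((d : ℝ) - 1) * t ^ 2 * (Real.cosh a - 1)) ^ 2 + 4 * (mm - 2 * ((d : ℝ) - 1) * t ^ 2 * (Real.cosh a - 1)) * t ^ 2)) +
        2 * Real.sinh a / (mm - 2 * (d : ℝ) * t ^ 2 * (Real.cosh a - 1))) ν ≤ C)
    (hCK : C ≤ K / Real.sqrt mm)
    (hmK : 2 * ((|t| * (2 * Mφ * Mφ' * εU)) * (Real.exp κ' + 1) * (d : ℝ) * K) ≤ Real.sqrt mm) (y : TSite d (fineP L m)) :
    ‖WL2.equiv ℂ (fun _ : TSite d (fineP L m) => c₁) V (covDivL2K ℂ c₁ (t : ℂ) (adTransportW φ fun bb => (U bb)⁻¹) u) y‖ ≤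
      2 * Real.exp (a * ((L : ℝ) - 1)) *
        ((2 * ‖(t : ℂ)‖ * ∑ ν, (fun ν : Fin d => (1 + Real.exp (-a)) *
            ((1 + 2 * t / (fineP L m ν * Real.sqrt (mm - 2 * ((d : ℝ) - 1) * t ^ 2 * (Real.cosh a - 1)))) /
              Real.sqrt ((mm - 2 * ((d : ℝ) - 1) * t ^ 2 * (Real.cosh a - 1)) ^ 2 + 4 * (mm - 2 * ((d : ℝ) - 1) * t ^ 2 * (Real.cosh a - 1)) * t ^ 2)) +
            2 * Real.sinh a / (mm - 2 * (d : ℝ) * t ^ 2 * (Real.cosh a - 1))) ν) +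
          (2 * (‖(t : ℂ)‖ * ((cP + ‖((mm : ℝ) : ℂ)‖) +
              (d : ℝ) * (t ^ 2 * (2 * Mφ * Mφ' * aU + (2 * Mφ * Mφ' * εU) * (2 * Mφ * Mφ' * εU)))) + |t| * (2 * Mφ * Mφ' * εU) / β) *
            (∑ ν, (fun ν : Fin d => (1 + Real.exp (-a)) *
              ((1 + 2 * t / (fineP L m ν * Real.sqrt (mm - 2 * ((d : ℝ) - 1) * t ^ 2 * (Real.cosh a - 1)))) /
                Real.sqrt ((mm - 2 * ((d : ℝ) - 1) * t ^ 2 * (Real.cosh a - 1)) ^ 2 + 4 * (mm - 2 * ((d : ℝ) - 1) * t ^ 2 * (Real.cosh a - 1)) * t ^ 2)) +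
              2 * Real.sinh a / (mm - 2 * (d : ℝ) * t ^ 2 * (Real.cosh a - 1))) ν)) * Cu) * F * Real.exp (-(κ * tdist m (blockCoord L m y) v)) := by
  have hδ0 : 0 ≤ 2 * Mφ * Mφ' * εU := by positivity
  have hb' : 0 ≤ 2 * Mφ * Mφ' * aU := by positivity
  have hmK' : 2 * (((0 : ℝ) / 1 + |t| * (2 * Mφ * Mφ' * εU)) * (Real.exp κ' + 1) * (d : ℝ) * K) ≤ Real.sqrt mm := by
    rwa [zero_div, zero_add]
  have h := norm_covDivL2K_le_blockLetter L m hm φ t mm a hmm (fun _ : Bond d (fineP L m) => (1 : TSite d (fineP L m) → 𝔸ˣ))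
    (fun _ x v v' => inner_AdW_one φ x v v') ht ha hlam hn (adTransportW φ U) (adTransportW φ fun bb => (U bb)⁻¹)
    (fun b w => adTransportW_inv_adTransportW φ U b w) hR hS P u f hu v hF hCu hκ hκa hcP hfv hfF hudec hPuv
    (fun (_ : Bond d (fineP L m)) (_ : TSite d (fineP L m)) => (1 : ℝ)) (fun _ _ => by simp) (fun _ => rfl) (fun _ => rfl)
    (c := 0) (r := 1) (by norm_num) (by norm_num) (fun _ _ _ => by simp) (fun _ _ _ => by simp) (fun _ _ _ => by norm_num)
    (fun _ : Bond d (fineP L m) => (Set.univ : Set (TSite d (fineP L m)))) (fun _ x hx => absurd (Set.mem_univ x) hx)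
    hδ0 hδ0 hb' (fun b₀ w => norm_sub_pureGauge_le φ hφ hφ' hMφ' U hU1 hUε b₀ w)
    (fun _ x _ μ w => norm_rel_sub_le φ hφ hφ' hMφ' U hU1 hUε (x, μ) w)
    (fun _ x _ μ w => norm_rel_sub_le φ hφ hφ' hMφ' U hU1 hUε (unshift μ x, μ) w)
    (fun _ x _ μ w => norm_inv_sub_le φ hφ hφ' hMφ' U hU1 hUε (unshift μ x, μ) w)
    (fun _ x _ μ w => norm_covDiff_le φ hφ hφ' hMφ hMφ' U hU1 hUa x μ w) hβ hβB haκ hC htB hCK hmK' y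
  refine h.trans (le_of_eq ?_)
  simp only [zero_div, mul_zero, zero_mul, zero_add, add_zero]

end Literature.MathematicalPhysics.QuantumFieldTheory.Balaban1983to89.B9Eq326LocalPartDivergenceBlockLetterSmallGauge

end
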